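import Summits.QuantumFields.YangMills.Theorems.UnitScaleTiltProp7CovAgmonWindow
import Summits.QuantumFields.YangMills.Theorems.UnitScaleTiltProp7CovInterpKernelDual
import Summits.QuantumFields.YangMills.Theorems.UnitScaleTiltProp7InterpErrorLocalLaplaceEnergy
import Summits.QuantumFields.YangMills.Theorems.UnitScaleTiltProp7CentrePinnedHessianPoincareCovMember
import Summits.QuantumFields.YangMills.Theorems.UnitScaleTiltProp7CovariantActionHS
import HarnessLib

/-!
# Route `UnitScaleTilt`, crux K1 «MinimiserStabilityRegPr» (stmt-QuantumFields-19200), route-R E′ path (α′), (E1-b) covariant, row (hK₂-cov) — F1-cov (E-loc-cov):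
# THE LOCAL `Δ_U`-ENERGY OF THE COVARIANT PINNED-BIHARMONIC INTERPOLATION ERROR — `Σ_{tdist(z,x₀) ≤ R} hs(Δ_U(φ − φ_H)(z)) ≤ 9·e^{2κ(1+R∕ℓ)}·(2 + π√dℓ∕(2κ))^d·M²`
# AT EVERY BASE POINT `x₀`, FROM THE COVARIANT AGMON WINDOW WITH THE RECIPROCAL (DECAYING) WEIGHT; AND ITS MEMBER INSTANCE WITH (D1-cov) DISCHARGED

Cell `ym3-torus`, width seat `ym3-torus-px4` (gen 3); ★routeR-w3 g6 NAMER WORD (9b) 2026-08-28T21:58:57Z «px4 g3: F1-cov» = px11 g3's LOCATE-HK2COV #57 §4 F1-cov spec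
(«(E-loc-cov) = px7 ✓p669609 §2–§3 transcribed over routeR-w6 F3b»).  THEOREMS ONLY (0 `def`, 0 `sorry`); `--supports stmt-QuantumFields-19200`, count-neutral.
YM₃ on T³ is a ladder rung (R3), not the Clay problem; nothing here claims a stub, the crux, d = 4 or the mass gap.

THE CHAIN (all by name).  `Δ_U(φ − φ_H) = Δ_Uφ − Δ_Uφ_H` (✓ `covLaplace_sub`) and `Σ⟨Δ_Uφ_H, Δ_Uv⟩ = Σ⟨Δ_U²φ_H, v⟩ = 0` for pinned `v` (✓ `sum_re_trace_covLaplace_comm`, `Δ_U²φ_H = 0`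
off `C`) give the type-1 EL identity (§1); the covariant Agmon WINDOW ✓ `Prop7CovAgmonWindow.weighted_covLaplace_le_window` (over ym-routeR-w6 g6's core ✓
`Prop7CovAgmonDecay.weighted_covLaplace_le_core`) at the RECIPROCAL `ω = 1∕w` of the growing scalar weight ✓ `Prop7TorusAgmonWeight.exists_admissible_weight (x₀)` (reciprocal rows
by px7's ✓ `Prop7InterpErrorLocalLaplaceEnergy.inv_rows_of_rows`) gives `√Σω²hs(Δ_Ue) ≤ 3√Σω²hs(Δ_Uφ)`; `Σω² ≤ (2 + π√dℓ∕(2κ))^d` (✓ `Prop7TorusExpWeightSum.sum_exp_neg_tdist_div_le`) and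
`ω ≥ e^{−κ(1+R∕ℓ)}` on the ball finish.  Every weight∕count letter is SCALAR — the covariant content is F3b + (D1-cov).

WHAT IS PROVED (ns `…Theorems.Prop7CovInterpErrorLocalLaplaceEnergy`; torus `T^{(i)}`, unitary `U`, `N × N` matrix fields, `hs X = Σ_{jk}|X_jk|²`).
* §1 ★ `el_of_covBiharmonic_off` — the `hEL` row of the window∕core for `e = φ − φ_H` with `h := Δ_Uφ`, `ht := 0`, `s := 0`; `sum_weighted_hs_zero` (bookkeeping).
* §2 ★★ `sum_ball_hs_covLaplace_interp_error_le` — abstract centre set `C`, the (D1-cov) root row `hP` (constant `A`) and the two ℓ-free window rows `(4κ∕ℓ)√d√A ≤ 1∕100`,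
  `((16κ+32κ²)∕ℓ²)dA ≤ 1∕50` DISPLAYED; datum row `hs(Δ_Uφ z) ≤ M²`; conclusion above (px7's flat constants verbatim).
* §2b ★ `sum_ball_hs_covLaplace_interp_le` — (V-loc-cov): the ball mass of `V := Δ_Uφ_H` is `≤ 2·#ball·M² + 18·e^{2κ(1+R∕ℓ)}(2 + π√dℓ∕(2κ))^d·M²` (twin of px7's
  ✓ `Prop7InterpErrorPinReaction.sum_ball_sq_laplace_interp_le`; the card is px7's ✓ `card_ball_le` at the member).
* §3 ★★★ `sum_ball_hs_covLaplace_interp_error_le_member` — the member of record (`PV 2 ℓ m K`, `k = K − n`, `U := unitsField (toUField W)`, `C := range (embIter (K−n))`, SU(2)):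
  `hU` (✓ `unitsField_mem_unitaryUnits`) and `hP` (✓ `Prop7CentrePinnedHessianPoincareCovMember.sqrt_sum_hs_le_of_regPr'`, i.e. (D1-cov) with frames AND plaquette datum from
  `RegPr`) DISCHARGED; displayed: `RegPr`, `M·α₀ ≤ a₅`, the (D1-cov) window, the rate `κ` with its two windows written at `A := √(2(κ₁ℓ_k⁴ + (κ₁ℓ_k⁴(2da + 8dτ₁²))²))`
  (`a = α₀L^{−2(K−n)}`, `τ₁ = ηC′e^{ηC′}`; `A ≍ ℓ_k²`, so both windows are ℓ_k-free smallness conditions on `κ`), the pinning∕biharmonicity of `φ_H`, the datum row.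
HONEST SCOPE.  Transcription of px7's flat file onto routeR-w6's covariant core; no new estimate; the absolute choice of `κ` (px7's `κ₀ = 1∕(3000√C_G)` analogue) is left to the
(hK₂-cov) assembly (px11's F4-cov), which reads `A ≍ ℓ_k²` off the displayed expression.

References: T. Bałaban, CMP 96 (1984) 223–250 [Balaban1984PropagatorsII] ((1.9) p.226); CMP 102 (1985) 277–309 [Balaban1985Variational] ((2) p.278, Prop. 7 p.299); CMP 99 (1985)
389–434 [Balaban1985BackgroundPropagators] ((3.8) p.392, (3.35) p.396).
-/

set_option autoImplicit false

noncomputable section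

open scoped BigOperators Matrix.Norms.L2Operator Matrix

namespace Summit.QuantumFields.YangMills.Theorems.Prop7CovInterpErrorLocalLaplaceEnergy

open Literature.MathematicalPhysics.QuantumFieldTheory.Balaban1983to89
open B9Eq39Adjoint (covD divB)
open B9TorusCalculus (torusT)
open Summit.QuantumFields.YangMills.Theorems.Prop7CovAgmonWindow (weighted_covLaplace_le_window)
open Summit.QuantumFields.YangMills.Theorems.Prop7CovInterpKernelDual (covLaplace_sub sum_re_trace_covLaplace_comm)
open Summit.QuantumFields.YangMills.Theorems.Prop7InterpErrorLocalLaplaceEnergy (inv_rows_of_rows)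
open Summit.QuantumFields.YangMills.Theorems.Prop7TorusAgmonWeight (exists_admissible_weight)
open Summit.QuantumFields.YangMills.Theorems.Prop7TorusExpWeightSum (sum_exp_neg_tdist_div_le)
open Summit.QuantumFields.YangMills.Theorems.Prop7CovariantCoercivity (sum_norm_sq_sub_le)

variable {P : Params} {i : ℕ} {N : ℕ}
variable {U : Fin P.d → Site P i → (Matrix (Fin N) (Fin N) ℂ)ˣ}

/-! ## §1 The Euler–Lagrange identity of the interpolation error (type 1: `h = Δ_Uφ`, `h̃ = 0`, `s = 0`) -/

/-- ★ **THE TYPE-1 EULER–LAGRANGE IDENTITY OF THE COVARIANT INTERPOLATION ERROR.**  If `φ_H` is `Δ_U`-biharmonic off `C` then `e := φ − φ_H` satisfies, for every `v`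
vanishing on `C`: `Σ⟨Δ_Ue, Δ_Uv⟩ = Σ⟨Δ_Uφ, Δ_Uv⟩ + Σ_{x,μ}⟨0, D_μv⟩ + Σ⟨0, v⟩` (`Σ⟨Δ_Uφ_H, Δ_Uv⟩ = Σ⟨Δ_U²φ_H, v⟩ = 0` by ✓ `sum_re_trace_covLaplace_comm`) — the `hEL` row of
✓ `weighted_covLaplace_le_core` ∕ `_window` with `h := Δ_Uφ`, `ht := 0`, `s := 0`; covariant twin of ✓ `Prop7PinnedBiharmonicAgmonDecay.el_of_biharmonic_off`.
[cite: Balaban1984PropagatorsII, (1.9) p.226; Balaban1985BackgroundPropagators, (3.8) p.392] -/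
theorem el_of_covBiharmonic_off (hU : ∀ ν x, (U ν x : Matrix (Fin N) (Fin N) ℂ) ∈ unitary (Matrix (Fin N) (Fin N) ℂ))
    (C : Set (Site P i)) (φ φH : Site P i → Matrix (Fin N) (Fin N) ℂ)
    (hEL : ∀ x ∉ C, divB (torusT P i) U (fun μ => covD (torusT P i) U μ
      (fun y => divB (torusT P i) U (fun ν => covD (torusT P i) U ν φH) y)) x = 0) :
    ∀ v : Site P i → Matrix (Fin N) (Fin N) ℂ, (∀ y ∈ C, v y = 0) →
      ∑ x, (((divB (torusT P i) U (fun μ => covD (torusT P i) U μ (fun z => φ z - φH z)) x)ᴴ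
          * divB (torusT P i) U (fun μ => covD (torusT P i) U μ v) x).trace).re
        = ∑ x, (((divB (torusT P i) U (fun μ => covD (torusT P i) U μ φ) x)ᴴ * divB (torusT P i) U (fun μ => covD (torusT P i) U μ v) x).trace).re
          + ∑ x, ∑ μ, ((((fun (_ : Fin P.d) (_ : Site P i) => (0 : Matrix (Fin N) (Fin N) ℂ)) μ x)ᴴ * covD (torusT P i) U μ v x).trace).re
          + ∑ x, ((((fun (_ : Site P i) => (0 : Matrix (Fin N) (Fin N) ℂ)) x)ᴴ * v x).trace).re := by
  classical
  intro v hv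
  -- the two zero source sums
  have hz1 : ∑ x, ∑ μ, ((((fun (_ : Fin P.d) (_ : Site P i) => (0 : Matrix (Fin N) (Fin N) ℂ)) μ x)ᴴ * covD (torusT P i) U μ v x).trace).re = 0 := by
    simp
  have hz2 : ∑ x, ((((fun (_ : Site P i) => (0 : Matrix (Fin N) (Fin N) ℂ)) x)ᴴ * v x).trace).re = 0 := by simp
  rw [hz1, hz2, add_zero, add_zero]
  -- `⟨Δ_Uφ_H, Δ_Uv⟩` summed is `⟨Δ_U²φ_H, v⟩` summed, which vanishes termwise
  have hH0 : ∑ x, (((divB (torusT P i) U (fun μ => covD (torusT P i) U μ φH) x)ᴴ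
      * divB (torusT P i) U (fun μ => covD (torusT P i) U μ v) x).trace).re = 0 := by
    rw [← sum_re_trace_covLaplace_comm hU (fun y => divB (torusT P i) U (fun ν => covD (torusT P i) U ν φH) y) v]
    refine Finset.sum_eq_zero fun x _ => ?_
    by_cases hx : x ∈ C
    · rw [hv x hx, mul_zero, Matrix.trace_zero, Complex.zero_re]
    · rw [hEL x hx, Matrix.conjTranspose_zero, zero_mul, Matrix.trace_zero, Complex.zero_re]
  -- linearity of `Δ_U`
  have hsub : ∀ x, divB (torusT P i) U (fun μ => covD (torusT P i) U μ (fun z => φ z - φH z)) x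
      = divB (torusT P i) U (fun μ => covD (torusT P i) U μ φ) x - divB (torusT P i) U (fun μ => covD (torusT P i) U μ φH) x :=
    fun x => covLaplace_sub φ φH x
  simp_rw [hsub, Matrix.conjTranspose_sub, sub_mul, Matrix.trace_sub, Complex.sub_re, Finset.sum_sub_distrib, hH0, sub_zero]

/-! ## §2 ★★ The local `Δ_U`-energy of the covariant interpolation error — abstract centre set, (D1-cov) root row and the window displayed -/

/-- `hs 0 = 0`-bookkeeping: the weighted size of the zero bond∕site sources vanishes. [folklore] -/
theorem sum_weighted_hs_zero (ω : Site P i → ℝ) :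
    (∑ x : Site P i, ∑ _μ : Fin P.d, ω x ^ 2 * ∑ j : Fin N, ∑ k : Fin N, ‖((fun (_ : Fin P.d) (_ : Site P i) => (0 : Matrix (Fin N) (Fin N) ℂ)) _μ x) j k‖ ^ 2) = 0 ∧
    (∑ x : Site P i, ω x ^ 2 * ∑ j : Fin N, ∑ k : Fin N, ‖((fun (_ : Site P i) => (0 : Matrix (Fin N) (Fin N) ℂ)) x) j k‖ ^ 2) = 0 := by
  constructor <;> simp

/-- ★★ **LOCAL `Δ_U`-ENERGY OF THE COVARIANT INTERPOLATION ERROR (abstract form).**  Unitary background `U` on `T^{(i)}`, centre set `C`, base point `x₀`, scale `ℓ ≥ 1`, rate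
`0 < κ ≤ 1∕8`; the pinned covariant Poincaré row in root form (constant `A ≥ 0`; ✓ `…CovFramesRoot` ∕ ✓ `…CovMember` at the member) and the two ℓ-free window rows
`(4κ∕ℓ)·√d·√A ≤ 1∕100`, `((16κ + 32κ²)∕ℓ²)·d·A ≤ 1∕50` DISPLAYED; `φ_H` a pinned interpolant of `φ|_C`, `Δ_U`-biharmonic off `C`; `hs(Δ_Uφ z) ≤ M²` everywhere.  Then for
every radius `R`:  `Σ_{tdist(z,x₀) ≤ R} hs(Δ_U(φ − φ_H)(z)) ≤ 9·e^{2κ(1+R∕ℓ)}·(2 + π√d·ℓ∕(2κ))^d·M²` — ✓ `weighted_covLaplace_le_window` at the RECIPROCAL of ✓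
`exists_admissible_weight (x₀)` (rows by ✓ `inv_rows_of_rows`), the count ✓ `sum_exp_neg_tdist_div_le`, and `ω ≥ e^{−κ(1+R∕ℓ)}` on the ball.  Covariant twin of px7's ✓
`Prop7InterpErrorLocalLaplaceEnergy.sum_ball_sq_laplace_interp_error_le`. [cite: Balaban1984PropagatorsII, (1.9) p.226; Balaban1985Variational, Prop. 7 p.299] -/
theorem sum_ball_hs_covLaplace_interp_error_le (hU : ∀ ν x, (U ν x : Matrix (Fin N) (Fin N) ℂ) ∈ unitary (Matrix (Fin N) (Fin N) ℂ))
    (C : Set (Site P i)) (x₀ : Site P i) {ℓ κ A R M : ℝ}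
    (hℓ : 1 ≤ ℓ) (hκ0 : 0 < κ) (hκ1 : κ ≤ 1 / 8) (hA : 0 ≤ A)
    (hP : ∀ v : Site P i → Matrix (Fin N) (Fin N) ℂ, (∀ y ∈ C, v y = 0) →
      Real.sqrt (∑ x, ∑ j : Fin N, ∑ k : Fin N, ‖(v x) j k‖ ^ 2)
        ≤ A * Real.sqrt (∑ x, ∑ j : Fin N, ∑ k : Fin N, ‖(divB (torusT P i) U (fun μ => covD (torusT P i) U μ v) x) j k‖ ^ 2))
    (hwin₁ : 4 * κ / ℓ * Real.sqrt P.d * Real.sqrt A ≤ 1 / 100)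
    (hwin₂ : (16 * κ + 32 * κ ^ 2) / ℓ ^ 2 * P.d * A ≤ 1 / 50)
    (φ φH : Site P i → Matrix (Fin N) (Fin N) ℂ) (hH : ∀ x ∈ C, φH x = φ x)
    (hEL : ∀ x ∉ C, divB (torusT P i) U (fun μ => covD (torusT P i) U μ
      (fun y => divB (torusT P i) U (fun ν => covD (torusT P i) U ν φH) y)) x = 0)
    (hφ : ∀ z, ∑ j : Fin N, ∑ k : Fin N, ‖(divB (torusT P i) U (fun μ => covD (torusT P i) U μ φ) z) j k‖ ^ 2 ≤ M ^ 2) :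
    ∑ z ∈ Finset.univ.filter (fun z : Site P i => (Site.tdist z x₀ : ℝ) ≤ R),
        ∑ j : Fin N, ∑ k : Fin N, ‖(divB (torusT P i) U (fun μ => covD (torusT P i) U μ (fun x => φ x - φH x)) z) j k‖ ^ 2
      ≤ 9 * Real.exp (2 * κ * (1 + R / ℓ)) * (2 + Real.pi * Real.sqrt P.d * ℓ / (2 * κ)) ^ P.d * M ^ 2 := by
  classical
  have hℓ0 : 0 < ℓ := by linarith
  have hπ := Real.pi_pos
  have hd0 : 0 < (P.d : ℝ) := by exact_mod_cast Nat.lt_of_lt_of_le Nat.zero_lt_one P.hd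
  have hsd : 0 < Real.sqrt P.d := Real.sqrt_pos.mpr hd0
  -- the growing weight at base `x₀` and its reciprocal
  obtain ⟨w, hw₀, hw₁, hw₂, hlo, hhi⟩ := exists_admissible_weight x₀ hℓ hκ0.le (by linarith : κ ≤ 1)
  have ha : 2 * κ / ℓ ≤ 1 / 2 := by
    rw [div_le_iff₀ hℓ0]; nlinarith
  obtain ⟨hω₀, hω₁, hω₂⟩ := inv_rows_of_rows w ha hw₀ hw₁ hw₂
  set ω : Site P i → ℝ := fun x => (w x)⁻¹ with hωdef
  have ea : 2 * (2 * κ / ℓ) = 4 * κ / ℓ := by ring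
  have eb : 4 * (4 * κ / ℓ ^ 2) + 8 * (2 * κ / ℓ) ^ 2 = (16 * κ + 32 * κ ^ 2) / ℓ ^ 2 := by
    field_simp
    ring
  have hω₁' : ∀ x μ, |ω (x.shift μ) - ω x| ≤ (4 * κ / ℓ) * ω x ∧ |ω (x.unshift μ) - ω x| ≤ (4 * κ / ℓ) * ω x := by
    intro x μ; rw [← ea]; exact hω₁ x μ
  have hω₂' : ∀ x μ, |ω (x.shift μ) + ω (x.unshift μ) - 2 * ω x| ≤ ((16 * κ + 32 * κ ^ 2) / ℓ ^ 2) * ω x := by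
    intro x μ; rw [← eb]; exact hω₂ x μ
  have ha' : 4 * κ / ℓ ≤ 1 / 2 := by rw [div_le_iff₀ hℓ0]; nlinarith
  -- the interpolation error is pinned and satisfies the type-1 EL identity
  have he : ∀ y ∈ C, (fun x => φ x - φH x) y = 0 := fun y hy => by simp [hH y hy]
  have hEL' := el_of_covBiharmonic_off hU C φ φH hEL
  have hwin₁' : 4 * κ / ℓ * Real.sqrt P.d * Real.sqrt A ≤ 1 / 100 := hwin₁
  have hwl := (weighted_covLaplace_le_window hU C ω (fun x => φ x - φH x)
    (fun x => divB (torusT P i) U (fun μ => covD (torusT P i) U μ φ) x)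
    (fun _ => (0 : Matrix (Fin N) (Fin N) ℂ)) (fun _ _ => (0 : Matrix (Fin N) (Fin N) ℂ))
    (by positivity) (by positivity) hA hω₀ hω₁' hω₂' hP he hEL' ha' hwin₁' hwin₂).1
  obtain ⟨hz1, hz2⟩ := sum_weighted_hs_zero (P := P) (i := i) (N := N) ω
  rw [hz1, hz2, Real.sqrt_zero, mul_zero, mul_zero, add_zero, add_zero] at hwl
  -- square it: `E ≤ 9·F`
  set E : ℝ := ∑ x, ω x ^ 2 * ∑ j : Fin N, ∑ k : Fin N,
      ‖(divB (torusT P i) U (fun μ => covD (torusT P i) U μ (fun x => φ x - φH x)) x) j k‖ ^ 2 with hE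
  set F : ℝ := ∑ x, ω x ^ 2 * ∑ j : Fin N, ∑ k : Fin N, ‖(divB (torusT P i) U (fun μ => covD (torusT P i) U μ φ) x) j k‖ ^ 2 with hF
  have hhs0 : ∀ X : Matrix (Fin N) (Fin N) ℂ, 0 ≤ ∑ j : Fin N, ∑ k : Fin N, ‖X j k‖ ^ 2 :=
    fun X => Finset.sum_nonneg fun _ _ => Finset.sum_nonneg fun _ _ => sq_nonneg _
  have hE0 : 0 ≤ E := Finset.sum_nonneg fun _ _ => mul_nonneg (sq_nonneg _) (hhs0 _)
  have hF0 : 0 ≤ F := Finset.sum_nonneg fun _ _ => mul_nonneg (sq_nonneg _) (hhs0 _)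
  have hEF : E ≤ 9 * F := by
    have h1 : Real.sqrt E ^ 2 ≤ (3 * Real.sqrt F) ^ 2 := pow_le_pow_left₀ (Real.sqrt_nonneg _) hwl 2
    rw [Real.sq_sqrt hE0, mul_pow, Real.sq_sqrt hF0] at h1
    linarith
  -- the weighted size of the datum: `F ≤ M²·Σω² ≤ M²·(2 + π√dℓ∕(2κ))^d`
  set a' : ℝ := 2 * κ / (Real.pi * Real.sqrt P.d) with ha'def
  have ha'0 : 0 < a' := by rw [ha'def]; positivity
  have hcount : ∑ x : Site P i, ω x ^ 2 ≤ (2 + Real.pi * Real.sqrt P.d * ℓ / (2 * κ)) ^ P.d := by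
    have hs := sum_exp_neg_tdist_div_le x₀ ha'0 hℓ0
    have e2 : ℓ / a' = Real.pi * Real.sqrt P.d * ℓ / (2 * κ) := by
      rw [ha'def]; field_simp
    rw [e2] at hs
    refine le_trans (Finset.sum_le_sum fun z _ => ?_) hs
    have hz := hlo z
    have e1 : Real.exp (-(2 * a' / ℓ * (Site.tdist z x₀ : ℝ)))
        = (Real.exp (2 * κ / (Real.pi * Real.sqrt P.d * ℓ) * (Site.tdist z x₀ : ℝ)) ^ 2)⁻¹ := by
      rw [← Real.exp_nat_mul, ← Real.exp_neg, ha'def]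
      congr 1
      field_simp
      ring
    rw [e1, hωdef]
    dsimp only
    rw [inv_pow]
    exact inv_anti₀ (by positivity) (pow_le_pow_left₀ (Real.exp_pos _).le hz 2)
  have hM2 : 0 ≤ M ^ 2 := sq_nonneg _
  have hFM : F ≤ M ^ 2 * (2 + Real.pi * Real.sqrt P.d * ℓ / (2 * κ)) ^ P.d := by
    calc F ≤ ∑ x, ω x ^ 2 * M ^ 2 := Finset.sum_le_sum fun x _ => mul_le_mul_of_nonneg_left (hφ x) (sq_nonneg _)
      _ = M ^ 2 * ∑ x, ω x ^ 2 := by rw [← Finset.sum_mul]; ring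
      _ ≤ M ^ 2 * (2 + Real.pi * Real.sqrt P.d * ℓ / (2 * κ)) ^ P.d := mul_le_mul_of_nonneg_left hcount hM2
  -- on the ball the weight is at least `e^{−κ(1+R∕ℓ)}`
  have hball : ∀ z ∈ Finset.univ.filter (fun z : Site P i => (Site.tdist z x₀ : ℝ) ≤ R),
      ∑ j : Fin N, ∑ k : Fin N, ‖(divB (torusT P i) U (fun μ => covD (torusT P i) U μ (fun x => φ x - φH x)) z) j k‖ ^ 2
        ≤ Real.exp (2 * κ * (1 + R / ℓ)) * (ω z ^ 2 * ∑ j : Fin N, ∑ k : Fin N,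
            ‖(divB (torusT P i) U (fun μ => covD (torusT P i) U μ (fun x => φ x - φH x)) z) j k‖ ^ 2) := by
    intro z hz
    rw [Finset.mem_filter] at hz
    have hwz : w z ≤ Real.exp (κ * (1 + R / ℓ)) := by
      refine (hhi z).trans (Real.exp_le_exp.mpr ?_)
      have : (Site.tdist z x₀ : ℝ) / ℓ ≤ R / ℓ := div_le_div_of_nonneg_right hz.2 hℓ0.le
      nlinarith
    have hωz : Real.exp (-(κ * (1 + R / ℓ))) ≤ ω z := by
      rw [hωdef]; dsimp only
      rw [Real.exp_neg]
      exact inv_anti₀ (hw₀ z) hwz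
    have hωz0 : 0 ≤ Real.exp (-(κ * (1 + R / ℓ))) := (Real.exp_pos _).le
    set q := ∑ j : Fin N, ∑ k : Fin N, ‖(divB (torusT P i) U (fun μ => covD (torusT P i) U μ (fun x => φ x - φH x)) z) j k‖ ^ 2
    have hq0 : 0 ≤ q := hhs0 _
    calc q = Real.exp (2 * κ * (1 + R / ℓ)) * ((Real.exp (-(κ * (1 + R / ℓ)))) ^ 2 * q) := by
          rw [← Real.exp_nat_mul, ← mul_assoc, ← Real.exp_add]
          have : 2 * κ * (1 + R / ℓ) + ((2 : ℕ) : ℝ) * -(κ * (1 + R / ℓ)) = 0 := by push_cast; ring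
          rw [this, Real.exp_zero, one_mul]
      _ ≤ Real.exp (2 * κ * (1 + R / ℓ)) * (ω z ^ 2 * q) := by
          refine mul_le_mul_of_nonneg_left ?_ (Real.exp_pos _).le
          exact mul_le_mul_of_nonneg_right (pow_le_pow_left₀ hωz0 hωz 2) hq0
  calc ∑ z ∈ Finset.univ.filter (fun z : Site P i => (Site.tdist z x₀ : ℝ) ≤ R),
        ∑ j : Fin N, ∑ k : Fin N, ‖(divB (torusT P i) U (fun μ => covD (torusT P i) U μ (fun x => φ x - φH x)) z) j k‖ ^ 2
      ≤ ∑ z ∈ Finset.univ.filter (fun z : Site P i => (Site.tdist z x₀ : ℝ) ≤ R),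
          Real.exp (2 * κ * (1 + R / ℓ)) * (ω z ^ 2 * ∑ j : Fin N, ∑ k : Fin N,
            ‖(divB (torusT P i) U (fun μ => covD (torusT P i) U μ (fun x => φ x - φH x)) z) j k‖ ^ 2) := Finset.sum_le_sum hball
    _ = Real.exp (2 * κ * (1 + R / ℓ)) * ∑ z ∈ Finset.univ.filter (fun z : Site P i => (Site.tdist z x₀ : ℝ) ≤ R),
          (ω z ^ 2 * ∑ j : Fin N, ∑ k : Fin N,
            ‖(divB (torusT P i) U (fun μ => covD (torusT P i) U μ (fun x => φ x - φH x)) z) j k‖ ^ 2) := by rw [Finset.mul_sum]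
    _ ≤ Real.exp (2 * κ * (1 + R / ℓ)) * E := by
        refine mul_le_mul_of_nonneg_left ?_ (Real.exp_pos _).le
        exact Finset.sum_le_sum_of_subset_of_nonneg (Finset.filter_subset _ _) fun _ _ _ => mul_nonneg (sq_nonneg _) (hhs0 _)
    _ ≤ Real.exp (2 * κ * (1 + R / ℓ)) * (9 * (M ^ 2 * (2 + Real.pi * Real.sqrt P.d * ℓ / (2 * κ)) ^ P.d)) := by
        refine mul_le_mul_of_nonneg_left (hEF.trans ?_) (Real.exp_pos _).le
        linarith
    _ = 9 * Real.exp (2 * κ * (1 + R / ℓ)) * (2 + Real.pi * Real.sqrt P.d * ℓ / (2 * κ)) ^ P.d * M ^ 2 := by ring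

/-! ## §2b (V-loc-cov) The local mass of `V := Δ_Uφ_H` on a ball: datum + interpolation error -/

/-- ★ **(V-loc-cov)**: under the hypotheses of `sum_ball_hs_covLaplace_interp_error_le`, the ball mass of `V := Δ_Uφ_H = Δ_Uφ − Δ_U(φ − φ_H)` is at most
`2·#{tdist ≤ R}·M² + 18·e^{2κ(1+R∕ℓ)}·(2 + π√dℓ∕(2κ))^d·M²` (the card is px7's ✓ `card_ball_le` `≤ 216ℓ_k³` at the member for `R ≤ ℓ_k`). Covariant twin of px7's ✓
`Prop7InterpErrorPinReaction.sum_ball_sq_laplace_interp_le`. [cite: Balaban1984PropagatorsII, (1.9) p.226; Balaban1985Variational, Prop. 7 p.299] -/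
theorem sum_ball_hs_covLaplace_interp_le (hU : ∀ ν x, (U ν x : Matrix (Fin N) (Fin N) ℂ) ∈ unitary (Matrix (Fin N) (Fin N) ℂ))
    (C : Set (Site P i)) (x₀ : Site P i) {ℓ κ A R M : ℝ}
    (hℓ : 1 ≤ ℓ) (hκ0 : 0 < κ) (hκ1 : κ ≤ 1 / 8) (hA : 0 ≤ A)
    (hP : ∀ v : Site P i → Matrix (Fin N) (Fin N) ℂ, (∀ y ∈ C, v y = 0) →
      Real.sqrt (∑ x, ∑ j : Fin N, ∑ k : Fin N, ‖(v x) j k‖ ^ 2)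
        ≤ A * Real.sqrt (∑ x, ∑ j : Fin N, ∑ k : Fin N, ‖(divB (torusT P i) U (fun μ => covD (torusT P i) U μ v) x) j k‖ ^ 2))
    (hwin₁ : 4 * κ / ℓ * Real.sqrt P.d * Real.sqrt A ≤ 1 / 100)
    (hwin₂ : (16 * κ + 32 * κ ^ 2) / ℓ ^ 2 * P.d * A ≤ 1 / 50)
    (φ φH : Site P i → Matrix (Fin N) (Fin N) ℂ) (hH : ∀ x ∈ C, φH x = φ x)
    (hEL : ∀ x ∉ C, divB (torusT P i) U (fun μ => covD (torusT P i) U μ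
      (fun y => divB (torusT P i) U (fun ν => covD (torusT P i) U ν φH) y)) x = 0)
    (hφ : ∀ z, ∑ j : Fin N, ∑ k : Fin N, ‖(divB (torusT P i) U (fun μ => covD (torusT P i) U μ φ) z) j k‖ ^ 2 ≤ M ^ 2) :
    ∑ z ∈ Finset.univ.filter (fun z : Site P i => (Site.tdist z x₀ : ℝ) ≤ R),
        ∑ j : Fin N, ∑ k : Fin N, ‖(divB (torusT P i) U (fun μ => covD (torusT P i) U μ φH) z) j k‖ ^ 2
      ≤ 2 * ((Finset.univ.filter (fun z : Site P i => (Site.tdist z x₀ : ℝ) ≤ R)).card : ℝ) * M ^ 2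
        + 18 * Real.exp (2 * κ * (1 + R / ℓ)) * (2 + Real.pi * Real.sqrt P.d * ℓ / (2 * κ)) ^ P.d * M ^ 2 := by
  classical
  have hE := sum_ball_hs_covLaplace_interp_error_le (R := R) hU C x₀ hℓ hκ0 hκ1 hA hP hwin₁ hwin₂ φ φH hH hEL hφ
  set B := Finset.univ.filter (fun z : Site P i => (Site.tdist z x₀ : ℝ) ≤ R) with hB
  -- `Δ_Uφ_H = Δ_Uφ − Δ_U(φ − φ_H)` pointwise
  have hV : ∀ z, divB (torusT P i) U (fun μ => covD (torusT P i) U μ φH) z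
      = divB (torusT P i) U (fun μ => covD (torusT P i) U μ φ) z
        - divB (torusT P i) U (fun μ => covD (torusT P i) U μ (fun x => φ x - φH x)) z := by
    intro z
    rw [covLaplace_sub φ φH z]
    abel
  calc ∑ z ∈ B, ∑ j : Fin N, ∑ k : Fin N, ‖(divB (torusT P i) U (fun μ => covD (torusT P i) U μ φH) z) j k‖ ^ 2
      ≤ ∑ z ∈ B, (2 * ∑ j : Fin N, ∑ k : Fin N, ‖(divB (torusT P i) U (fun μ => covD (torusT P i) U μ φ) z) j k‖ ^ 2
          + 2 * ∑ j : Fin N, ∑ k : Fin N, ‖(divB (torusT P i) U (fun μ => covD (torusT P i) U μ (fun x => φ x - φH x)) z) j k‖ ^ 2) := by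
        refine Finset.sum_le_sum fun z _ => ?_
        rw [hV z]
        exact sum_norm_sq_sub_le _ _
    _ = 2 * ∑ z ∈ B, ∑ j : Fin N, ∑ k : Fin N, ‖(divB (torusT P i) U (fun μ => covD (torusT P i) U μ φ) z) j k‖ ^ 2
          + 2 * ∑ z ∈ B, ∑ j : Fin N, ∑ k : Fin N, ‖(divB (torusT P i) U (fun μ => covD (torusT P i) U μ (fun x => φ x - φH x)) z) j k‖ ^ 2 := by
        rw [Finset.sum_add_distrib, Finset.mul_sum, Finset.mul_sum]
    _ ≤ 2 * ((B.card : ℝ) * M ^ 2) + 2 * (9 * Real.exp (2 * κ * (1 + R / ℓ)) * (2 + Real.pi * Real.sqrt P.d * ℓ / (2 * κ)) ^ P.d * M ^ 2) := by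
        refine add_le_add (mul_le_mul_of_nonneg_left ?_ (by norm_num)) (mul_le_mul_of_nonneg_left hE (by norm_num))
        calc ∑ z ∈ B, ∑ j : Fin N, ∑ k : Fin N, ‖(divB (torusT P i) U (fun μ => covD (torusT P i) U μ φ) z) j k‖ ^ 2
            ≤ ∑ _z ∈ B, M ^ 2 := Finset.sum_le_sum fun z _ => hφ z
          _ = (B.card : ℝ) * M ^ 2 := by rw [Finset.sum_const, nsmul_eq_mul]
    _ = 2 * (B.card : ℝ) * M ^ 2 + 18 * Real.exp (2 * κ * (1 + R / ℓ)) * (2 + Real.pi * Real.sqrt P.d * ℓ / (2 * κ)) ^ P.d * M ^ 2 := by ring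

/-! ## §3 ★★★ The member of record: `C = range (embIter (K − n))`, `U = unitsField (toUField W)`, (D1-cov) DISCHARGED by ✓ `sqrt_sum_hs_le_of_regPr'`; the rate `κ` and its
two ℓ_k-free windows stay displayed -/

section Member

open Literature.MathematicalPhysics.QuantumFieldTheory.Balaban1983to89.T3ContinuumYM3Torus
open Literature.MathematicalPhysics.QuantumFieldTheory.Balaban1983to89.T3PrintedRegularMinimiser (RegPr)
open Literature.MathematicalPhysics.QuantumFieldTheory.Balaban1983to89.B6GlobalChartV1 (PV)
open B10Eq27TorusAxialLog (unitsField toUField)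
open B15DeterminingSets (embIter)
open Summit.QuantumFields.YangMills.Theorems.Prop7SectET3Members (hd3)
open Summit.QuantumFields.YangMills.Theorems.Prop7CentrePinnedHessianPoincareCovMember (sqrt_sum_hs_le_of_regPr')

variable {ℓ : ℕ} {hL : Odd (ℓ + 1) ∧ 1 < ℓ + 1}

/-- ★★★ **LOCAL `Δ_W`-ENERGY OF THE COVARIANT INTERPOLATION ERROR AT THE MEMBER OF RECORD, (D1-cov) DISCHARGED.**  For `W ∈ RegPr` (`M·α₀ ≤ a₅`) under the (D1-cov) window
(✓ `sqrt_sum_hs_le_of_regPr'`, giving the Poincaré constant `A := √(2(κ₁ℓ_k⁴ + (κ₁ℓ_k⁴(2da + 8dτ₁²))²))` at `a = α₀L^{−2(K−n)}`), every base point `x₀`, rate `0 < κ ≤ 1∕8` with the two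
windows `(4κ∕ℓ_k)√d·√A ≤ 1∕100`, `((16κ+32κ²)∕ℓ_k²)·d·A ≤ 1∕50` (`ℓ_k = L^{K−n}`; both ℓ_k-free since `A ≍ ℓ_k²`), every `φ` with `hs(Δ_Wφ) ≤ M_φ²` and every pinned
interpolant `φ_H` of `φ` on the `(K−n)`-centres, `Δ_W`-biharmonic off them:
`Σ_{tdist(z,x₀) ≤ R} hs(Δ_W(φ − φ_H)(z)) ≤ 9·e^{2κ(1+R∕ℓ_k)}·(2 + π√3·ℓ_k∕(2κ))³·M_φ²`.
[cite: Balaban1984PropagatorsII, (1.9) p.226; Balaban1985Variational, (2) p.278, Prop. 7 p.299; Balaban1985BackgroundPropagators, (3.35) p.396] -/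
theorem sum_ball_hs_covLaplace_interp_error_le_member (hℓ4 : 4 ≤ ℓ) :
    ∃ c35 a₅ : ℝ, 0 < c35 ∧ 0 < a₅ ∧
      ∀ (hℓ : 4 ≤ ℓ) (m : ℕ) (hm : 1 ≤ m) (n K a' R : ℕ) (hk1 : 1 ≤ K - n) (hsize : a' + 3 ≤ m + n) (hM8 : 8 ≤ (ℓ + 1) ^ a')
        (hR2 : 2 * (ℓ + 1) ^ 2 ≤ R) (α₀ : ℝ), 0 < α₀ → ((ℓ + 1 : ℕ) : ℝ) * (((ℓ + 1) ^ a' : ℕ) : ℝ) * α₀ ≤ a₅ →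
        ∀ W : GaugeField (PV 2 ℓ m K hd3 hL) 0 (Matrix.specialUnitaryGroup (Fin 2) ℂ),
          RegPr (⟨ℓ + 1, hL, m, hm⟩ : T3Family) n K α₀ W →
          (4 * 2197 * (24 * 289 * 24576 * 46116) : ℝ) * ((2 : ℕ) : ℝ) ^ 2 * ((((PV 2 ℓ m K hd3 hL).L : ℝ)) ^ (K - n)) ^ 4
              * ((((PV 2 ℓ m K hd3 hL).d : ℝ)) ^ 2 * (4 * ((2 : ℕ) : ℝ) * (α₀ * ((((PV 2 ℓ m K hd3 hL).L : ℝ))⁻¹) ^ (2 * (K - n))) ^ 2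
                + (2 * ((((ℓ + 1 : ℕ) : ℝ) ^ (K - n))⁻¹ * ((((ℓ + 1 : ℕ) : ℝ) ^ (K - n))⁻¹ * (c35 * (((ℓ + 1 : ℕ) : ℝ) * (((ℓ + 1) ^ a' : ℕ) : ℝ)) * α₀))
                    * Real.exp ((((ℓ + 1 : ℕ) : ℝ) ^ (K - n))⁻¹ * (c35 * (((ℓ + 1 : ℕ) : ℝ) * (((ℓ + 1) ^ a' : ℕ) : ℝ)) * α₀)))
                  + 4 * ((((ℓ + 1 : ℕ) : ℝ) ^ (K - n))⁻¹ * (c35 * (((ℓ + 1 : ℕ) : ℝ) * (((ℓ + 1) ^ a' : ℕ) : ℝ)) * α₀)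
                    * Real.exp ((((ℓ + 1 : ℕ) : ℝ) ^ (K - n))⁻¹ * (c35 * (((ℓ + 1 : ℕ) : ℝ) * (((ℓ + 1) ^ a' : ℕ) : ℝ)) * α₀))) ^ 2) ^ 2)) ≤ 1 / 4 →
          ∀ (x₀ : Site (PV 2 ℓ m K hd3 hL) 0) (κ Rb Mφ : ℝ), 0 < κ → κ ≤ 1 / 8 →
            4 * κ / (((ℓ + 1 : ℕ) : ℝ) ^ (K - n)) * Real.sqrt ((PV 2 ℓ m K hd3 hL).d : ℝ) * Real.sqrt (Real.sqrt (2 * ((4 * 2197 * (24 * 289 * 24576 * 46116) : ℝ) * ((2 : ℕ) : ℝ) ^ 2 * ((((PV 2 ℓ m K hd3 hL).L : ℝ)) ^ (K - n)) ^ 4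
                    + ((4 * 2197 * (24 * 289 * 24576 * 46116) : ℝ) * ((2 : ℕ) : ℝ) ^ 2 * ((((PV 2 ℓ m K hd3 hL).L : ℝ)) ^ (K - n)) ^ 4
                      * (2 * (PV 2 ℓ m K hd3 hL).d * (α₀ * ((((PV 2 ℓ m K hd3 hL).L : ℝ))⁻¹) ^ (2 * (K - n))) + 8 * (PV 2 ℓ m K hd3 hL).d
                        * ((((ℓ + 1 : ℕ) : ℝ) ^ (K - n))⁻¹ * (c35 * (((ℓ + 1 : ℕ) : ℝ) * (((ℓ + 1) ^ a' : ℕ) : ℝ)) * α₀)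
                          * Real.exp ((((ℓ + 1 : ℕ) : ℝ) ^ (K - n))⁻¹ * (c35 * (((ℓ + 1 : ℕ) : ℝ) * (((ℓ + 1) ^ a' : ℕ) : ℝ)) * α₀))) ^ 2)) ^ 2))) ≤ 1 / 100 →
            (16 * κ + 32 * κ ^ 2) / (((ℓ + 1 : ℕ) : ℝ) ^ (K - n)) ^ 2 * (PV 2 ℓ m K hd3 hL).d * (Real.sqrt (2 * ((4 * 2197 * (24 * 289 * 24576 * 46116) : ℝ) * ((2 : ℕ) : ℝ) ^ 2 * ((((PV 2 ℓ m K hd3 hL).L : ℝ)) ^ (K - n)) ^ 4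
                    + ((4 * 2197 * (24 * 289 * 24576 * 46116) : ℝ) * ((2 : ℕ) : ℝ) ^ 2 * ((((PV 2 ℓ m K hd3 hL).L : ℝ)) ^ (K - n)) ^ 4
                      * (2 * (PV 2 ℓ m K hd3 hL).d * (α₀ * ((((PV 2 ℓ m K hd3 hL).L : ℝ))⁻¹) ^ (2 * (K - n))) + 8 * (PV 2 ℓ m K hd3 hL).d
                        * ((((ℓ + 1 : ℕ) : ℝ) ^ (K - n))⁻¹ * (c35 * (((ℓ + 1 : ℕ) : ℝ) * (((ℓ + 1) ^ a' : ℕ) : ℝ)) * α₀)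
                          * Real.exp ((((ℓ + 1 : ℕ) : ℝ) ^ (K - n))⁻¹ * (c35 * (((ℓ + 1 : ℕ) : ℝ) * (((ℓ + 1) ^ a' : ℕ) : ℝ)) * α₀))) ^ 2)) ^ 2))) ≤ 1 / 50 →
            ∀ (φ φH : Site (PV 2 ℓ m K hd3 hL) 0 → Matrix (Fin 2) (Fin 2) ℂ),
              (∀ y : Site (PV 2 ℓ m K hd3 hL) (K - n), φH (embIter (K - n) y) = φ (embIter (K - n) y)) →
              (∀ x ∉ Set.range (embIter (P := PV 2 ℓ m K hd3 hL) (K - n)),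
                divB (torusT (PV 2 ℓ m K hd3 hL) 0) (fun κ' z => unitsField (toUField W) ⟨z, κ'⟩)
                  (fun μ => covD (torusT (PV 2 ℓ m K hd3 hL) 0) (fun κ' z => unitsField (toUField W) ⟨z, κ'⟩) μ
                    (fun y => divB (torusT (PV 2 ℓ m K hd3 hL) 0) (fun κ' z => unitsField (toUField W) ⟨z, κ'⟩)
                      (fun ν => covD (torusT (PV 2 ℓ m K hd3 hL) 0) (fun κ' z => unitsField (toUField W) ⟨z, κ'⟩) ν φH) y)) x = 0) →
              (∀ z, ∑ j : Fin 2, ∑ k : Fin 2, ‖(divB (torusT (PV 2 ℓ m K hd3 hL) 0) (fun κ' z => unitsField (toUField W) ⟨z, κ'⟩)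
                  (fun μ => covD (torusT (PV 2 ℓ m K hd3 hL) 0) (fun κ' z => unitsField (toUField W) ⟨z, κ'⟩) μ φ) z) j k‖ ^ 2 ≤ Mφ ^ 2) →
              ∑ z ∈ Finset.univ.filter (fun z : Site (PV 2 ℓ m K hd3 hL) 0 => (Site.tdist z x₀ : ℝ) ≤ Rb),
                  ∑ j : Fin 2, ∑ k : Fin 2, ‖(divB (torusT (PV 2 ℓ m K hd3 hL) 0) (fun κ' z => unitsField (toUField W) ⟨z, κ'⟩)
                    (fun μ => covD (torusT (PV 2 ℓ m K hd3 hL) 0) (fun κ' z => unitsField (toUField W) ⟨z, κ'⟩) μ (fun x => φ x - φH x)) z) j k‖ ^ 2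
                ≤ 9 * Real.exp (2 * κ * (1 + Rb / (((ℓ + 1 : ℕ) : ℝ) ^ (K - n))))
                    * (2 + Real.pi * Real.sqrt ((PV 2 ℓ m K hd3 hL).d : ℝ) * (((ℓ + 1 : ℕ) : ℝ) ^ (K - n)) / (2 * κ)) ^ (PV 2 ℓ m K hd3 hL).d * Mφ ^ 2 := by
  obtain ⟨c35, a₅, hc35, ha₅, H⟩ := sqrt_sum_hs_le_of_regPr' (hL := hL) hℓ4
  refine ⟨c35, a₅, hc35, ha₅, ?_⟩
  intro hℓ m hm n K a' R hk1 hsize hM8 hR2 α₀ hα₀ hMα W hreg hwinD x₀ κ Rb Mφ hκ0 hκ1 hwin₁ hwin₂ φ φH hH hEL hφ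
  have hP := H hℓ m hm n K a' R hk1 hsize hM8 hR2 α₀ hα₀ hMα W hreg hwinD
  have hU : ∀ (ν : Fin (PV 2 ℓ m K hd3 hL).d) (x : Site (PV 2 ℓ m K hd3 hL) 0),
      (((fun κ' z => unitsField (toUField W) ⟨z, κ'⟩) ν x : (Matrix (Fin 2) (Fin 2) ℂ)ˣ) : Matrix (Fin 2) (Fin 2) ℂ) ∈ unitary (Matrix (Fin 2) (Fin 2) ℂ) :=
    fun ν x => B7Prop2Explicit.mem_unitaryUnits.mp (B10Eq27TorusAxialLog.unitsField_mem_unitaryUnits (toUField W) ⟨x, ν⟩)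
  have hℓk : (1 : ℝ) ≤ ((ℓ + 1 : ℕ) : ℝ) ^ (K - n) := one_le_pow₀ (by exact_mod_cast Nat.succ_le_succ (Nat.zero_le ℓ))
  have hH' : ∀ x ∈ Set.range (embIter (P := PV 2 ℓ m K hd3 hL) (K - n)), φH x = φ x := by
    rintro x ⟨y, rfl⟩; exact hH y
  exact sum_ball_hs_covLaplace_interp_error_le hU (Set.range (embIter (P := PV 2 ℓ m K hd3 hL) (K - n))) x₀ hℓk hκ0 hκ1 (Real.sqrt_nonneg _)
    hP hwin₁ hwin₂ φ φH hH' hEL hφ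

end Member

end Summit.QuantumFields.YangMills.Theorems.Prop7CovInterpErrorLocalLaplaceEnergy

end
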